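import Summits.BirchSwinnertonDyer.Rank1Residual.AdditivePotMult.RankZeroChiBranch
import Summits.BirchSwinnertonDyer.Rank1Residual.Additive.RamifiedTwistTamagawa
import HarnessLib

/-!
# X3♯(M) / X4(M): `c_p(E) ∈ {1, 2, 4}`, hence `p ∤ c_p(E)`, at EVERY additive potentially multiplicative odd prime — the Tamagawa binder of the X3♯(M) rank-`0` `χ_p`-branch lever discharged at `p = 3` (cell `b2b-bsdres`, seat additive-p1, gen 7)

HONEST FRAMING (cell `b2b-bsdres`, run/shared/lean/b2b/bsd-rank1-residual/, verbatim in every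
file): the goal of the cell is to DELETE the COMBINATION-SHAPED residual classes of the
Birch–Swinnerton-Dyer formula for ALL analytic-rank `≤ 1` elliptic curves over `ℚ` — "full BSD
formula for every rank `≤ 1` curve in class `C`" assembled STRICTLY from published theorems — so
that the rank-`≤ 1` remainder becomes exactly the CONSTRUCTION-SHAPED classes, which are TYPED
(missing-input `Prop`s), NOT attempted. This is not "finishing BSD". The additive sub-cell (seats
additive-p1…p4) is a RESEARCH ROUTE on the construction-shaped classes X3/X4; sub-cell additive-p1
= the potentially MULTIPLICATIVE additive prime (X3♯(M) / X4(M)); no claim beyond the stated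
classes; the labels of X3/X4 are UNCHANGED by this file; nothing is booked.

Theorems only (no definition, no named fact). The local Tamagawa number at an additive,
potentially multiplicative, ODD prime `p` of ANY elliptic curve `E/ℚ` is `1`, `2` or `4`: by the
gen-6 kernel theorem `PotMult.exists_mult_pStar_twist_model` (this sub-cell,
`AdditivePotMult/PStarTwistModel.lean`) `E ≅ V^{(p*)}` for a globally minimal `V` MULTIPLICATIVE at
`p`, `p* = (−1)^{⌊p/2⌋} p = ±p`, so `E` has Kodaira type `Iₙ*` at `p` and Tate's algorithm Steps 6–7
give `c_p ∈ {1, 2, 4}` (seat additive-p4's `tamagawaNumberAt_twist_pm_p_mem`,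
`Additive/RamifiedTwistTamagawa.lean`, from the tree's discharged Kodaira–Néron index facts). Hence
**`p ∤ c_p(E)` for every `(E, p)` with `PotMult E p`, `p` odd — in particular at `p = 3`**, where
the generic additive bound `c_p ≤ 4 < p` (used in `RankZeroChiBranchImage.lean`, `p ≥ 5`) says
nothing.

Consequence (§2): the hypothesis `htam : p ∤ c_p(E)` of the X3♯(M) rank-`0` consumers
`ClassX3M.missingUpperBoundAt_rankZero_of_chiBranch` / `…bsdp_rankZero_of_chiBranch_of_shaAn_unit`
(`RankZeroChiBranch.lean`, p218059) is DISCHARGED at every odd `p`, so on X3♯(M) ∧ `r_an = 0` the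
upper half `ord_p #Ш(E) ≤ ord_p #Ш_an(E)` follows from the typed `χ_p`-branch input
(`ChiBranchLeadingTerm[Odd]At`, seat additive-p4, = [B∘C] at `T = 0`) with NO further binder, and
`BSD(E,p)` on the rows with `p ∤ #Ш_an(E)` — exactly as for X4(M) (where no Tamagawa binder ever
appeared). Census pointer (hyp SHARPENED-CONJECTURES §50, CHI-XM-R0, engine A = engine P): the
binder `H_tam` was recorded as binding ALONE on 72 of the 266 X3♯(M) window rows at `p = 3`
(`N < 2·10⁴`); by this file it binds on none (the local factor `c_3(E)` is never `3` on a
potentially multiplicative row; a recount of that column against `c_3 ∈ {2, 4}` is requested in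
HOME/INBOX.md). Labels UNCHANGED; the typed input is CONSTRUCTION-shaped; nothing booked.

References: [SilvermanATAEC1994] IV.9.4 Steps 6–7 (PDF pp. 345–346), Rem. IV.9.3, V.5.3;
[Delbourgo1998] Prop. 4 (p. 144), Lemma (ii) (p. 139).
-/

noncomputable section

open scoped Classical NumberField

open WeierstrassCurve NumberField Literature.NumberTheory.EllipticCurves
  Literature.NumberTheory.EllipticCurves.ModularForms
  Literature.NumberTheory.EllipticCurves.Rank1Residual
  Literature.NumberTheory.EllipticCurves.Rank1Residual.Typed
  IsDedekindDomain Rat.HeightOneSpectrum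

namespace Summit.BirchSwinnertonDyer.Rank1Residual.AdditivePotMult

open Additive

variable {W : WeierstrassCurve ℚ} [W.IsElliptic] {p : ℕ} [hp : Fact p.Prime]

/-! ### §1 The local Tamagawa number at an additive potentially multiplicative odd prime -/

/-- **`c_p(E) ∈ {1, 2, 4}` at an additive, potentially multiplicative, odd prime `p`** (any model
`W` of `E/ℚ`): `E ≅ V^{(p*)}` with `V` globally minimal and multiplicative at `p`
(`PotMult.exists_mult_pStar_twist_model`), `p* = ±p`, so Kodaira type `Iₙ*` and Tate's algorithm
Steps 6–7 apply (additive-p4's `tamagawaNumberAt_twist_pm_p_mem`).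
[cite: SilvermanATAEC1994, IV.9.4 Steps 6–7 (PDF pp. 345–346) with Rem. IV.9.3] -/
theorem PotMult.tamagawaNumberAt_eq_one_or_two_or_four (hpm : PotMult W p) (hp2 : p ≠ 2) :
    W.tamagawaNumberAt ((primesEquiv (R := 𝓞 ℚ)).symm ⟨p, hp.out⟩) = 1 ∨
      W.tamagawaNumberAt ((primesEquiv (R := 𝓞 ℚ)).symm ⟨p, hp.out⟩) = 2 ∨
      W.tamagawaNumberAt ((primesEquiv (R := 𝓞 ℚ)).symm ⟨p, hp.out⟩) = 4 := by
  obtain ⟨V, iV, iVm, C, hV, hC⟩ := hpm.exists_mult_pStar_twist_model hp2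
  have hd : ((-1 : ℚ) ^ (p / 2) * p) = p ∨ ((-1 : ℚ) ^ (p / 2) * p) = -p := by
    rcases neg_one_pow_eq_or ℚ (p / 2) with h | h <;> simp [h]
  exact tamagawaNumberAt_twist_pm_p_mem p hp2 V (Or.inr hV) hd C hC

/-- **`p ∤ c_p(E)` at an additive, potentially multiplicative, odd prime `p`** — including `p = 3`
(`c_3 ∈ {1, 2, 4}`, never `3`: Kodaira types `IV`, `IV*` do not occur on a potentially
multiplicative row). [cite: SilvermanATAEC1994, IV.9.4 Steps 6–7 (PDF pp. 345–346) with Rem. IV.9.3] -/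
theorem PotMult.not_dvd_tamagawaNumberAt (hpm : PotMult W p) (hp2 : p ≠ 2) :
    ¬ p ∣ W.tamagawaNumberAt ((primesEquiv (R := 𝓞 ℚ)).symm ⟨p, hp.out⟩) := by
  obtain ⟨V, iV, iVm, C, hV, hC⟩ := hpm.exists_mult_pStar_twist_model hp2
  have hd : ((-1 : ℚ) ^ (p / 2) * p) = p ∨ ((-1 : ℚ) ^ (p / 2) * p) = -p := by
    rcases neg_one_pow_eq_or ℚ (p / 2) with h | h <;> simp [h]
  exact not_dvd_tamagawaNumberAt_twist_pm_p p hp2 V (Or.inr hV) hd C hC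

/-- **X4(M): `p ∤ c_p(E)`.** [cite: SilvermanATAEC1994, IV.9.4 Steps 6–7 (PDF pp. 345–346)] -/
theorem ClassX4M.not_dvd_tamagawaNumberAt (hX : ClassX4M W p) :
    ¬ p ∣ W.tamagawaNumberAt ((primesEquiv (R := 𝓞 ℚ)).symm ⟨p, hp.out⟩) :=
  (ClassX4M.potMult W p hX).not_dvd_tamagawaNumberAt hX.p_ne_two

/-- **X3♯(M): `p ∤ c_p(E)`** — the binder `htam` of `ClassX3M.missingUpperBoundAt_rankZero_of_chiBranch`
holds on EVERY X3♯(M) pair, in particular at `p = 3`.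
[cite: SilvermanATAEC1994, IV.9.4 Steps 6–7 (PDF pp. 345–346)] -/
theorem ClassX3M.not_dvd_tamagawaNumberAt [W.IsGloballyMinimal] (hX : ClassX3M W p) :
    ¬ p ∣ W.tamagawaNumberAt ((primesEquiv (R := 𝓞 ℚ)).symm ⟨p, hp.out⟩) :=
  (ClassX3M.potMult W p hX).not_dvd_tamagawaNumberAt (ClassX3M.p_ne_two W p hX)

/-! ### §2 X3♯(M), rank `0`, EVERY odd `p` (so also `p = 3`): the upper half from the branch input alone -/

variable [W.IsGloballyMinimal]

/-- **X3♯(M), `r_an = 0`, any odd `p` (in particular `p = 3`): `Typed.MissingUpperBoundAt W p` from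
the typed `χ_p`-branch input ALONE** — the Tamagawa binder of
`ClassX3M.missingUpperBoundAt_rankZero_of_chiBranch` discharged by §1. Inputs: Delbourgo 1998
Prop. 4 (`hDel`), GZK, modularity, a parametrisation datum (`hmodD`), and the typed
`ChiBranchLeadingTermAt W p` (used iff `p ≡ 1 (mod 4)`) / `ChiBranchLeadingTermOddAt W p`
(iff `p ≡ 3 (mod 4)`). X3♯(M) stays CONSTRUCTION-SHAPED; nothing booked.
[cite: Delbourgo1998, Prop. 4 (p. 144) and Lemma (ii) (p. 139)]
[cite: SilvermanATAEC1994, IV.9.4 Steps 6–7 (PDF pp. 345–346)] -/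
theorem ClassX3M.missingUpperBoundAt_rankZero_of_chiBranch_of_odd
    (hDel : Delbourgo1998.prop4_rankZero_pow_dvd_constantCoeff)
    (hGZK : rank_eq_analyticRank_of_analyticRank_le_one) (hmod : hasEntireLFunction_rat)
    (hmodD : nonempty_modularParametrizationData)
    (hBCeven : ChiBranchLeadingTermAt W p) (hBCodd : ChiBranchLeadingTermOddAt W p)
    (hX : ClassX3M W p) (hr : W.analyticRank = 0) : MissingUpperBoundAt W p :=
  ClassX3M.missingUpperBoundAt_rankZero_of_chiBranch hDel hGZK hmod hmodD hBCeven hBCodd hX hr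
    hX.not_dvd_tamagawaNumberAt

/-- **X3♯(M), `r_an = 0`, any odd `p`, `p ∤ #Ш_an(E)`: `BSD(E,p)` from the typed `χ_p`-branch input
ALONE** (no Tamagawa binder). [cite: Delbourgo1998, Prop. 4 (p. 144)] -/
theorem ClassX3M.bsdp_rankZero_of_chiBranch_of_shaAn_unit_of_odd
    (hDel : Delbourgo1998.prop4_rankZero_pow_dvd_constantCoeff)
    (hGZK : rank_eq_analyticRank_of_analyticRank_le_one) (hmod : hasEntireLFunction_rat)
    (hmodD : nonempty_modularParametrizationData)
    (hBCeven : ChiBranchLeadingTermAt W p) (hBCodd : ChiBranchLeadingTermOddAt W p)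
    (hX : ClassX3M W p) (hr : W.analyticRank = 0)
    {q : ℚ} (hq : shaAn W = (q : ℂ)) (hv : padicValRat p q = 0) : BSDp W p :=
  ClassX3M.bsdp_rankZero_of_chiBranch_of_shaAn_unit hDel hGZK hmod hmodD hBCeven hBCodd hX hr
    hX.not_dvd_tamagawaNumberAt hq hv

/-- **X3♯(M) at `p = 3`, `r_an = 0`: the upper half `ord_3 #Ш(E) ≤ ord_3 #Ш_an(E)` from the typed
odd-branch input `ChiBranchLeadingTermOddAt W 3` ALONE** (`3 ≡ 3 (mod 4)`: the even-branch input is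
not used and is supplied vacuously — its premise `p % 4 = 1` fails). The 266 ‖ 151 X3♯(M) window
rows at `p = 3` (hyp census §50) carry no binder but the typed input. Nothing booked.
[cite: Delbourgo1998, Prop. 4 (p. 144)] -/
theorem ClassX3M.missingUpperBoundAt_three_rankZero_of_chiBranchOdd {W : WeierstrassCurve ℚ}
    [W.IsElliptic] [W.IsGloballyMinimal]
    (hDel : Delbourgo1998.prop4_rankZero_pow_dvd_constantCoeff)
    (hGZK : rank_eq_analyticRank_of_analyticRank_le_one) (hmod : hasEntireLFunction_rat)
    (hmodD : nonempty_modularParametrizationData)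
    (hBCodd : ChiBranchLeadingTermOddAt W 3) (hX : ClassX3M W 3) (hr : W.analyticRank = 0) :
    MissingUpperBoundAt W 3 := by
  refine ClassX3M.missingUpperBoundAt_rankZero_of_chiBranch_of_odd hDel hGZK hmod hmodD ?_ hBCodd
    hX hr
  -- the even-branch predicate is vacuous at `p = 3` (`3 % 4 ≠ 1`)
  intro V _ _ κ γ N _ f h4
  omega

/-- **X3♯(M) at `p = 3`, `r_an = 0`, `3 ∤ #Ш_an(E)`: `BSD(E,3)` from the typed odd-branch input
`ChiBranchLeadingTermOddAt W 3` ALONE.** [cite: Delbourgo1998, Prop. 4 (p. 144)] -/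
theorem ClassX3M.bsdp_three_rankZero_of_chiBranchOdd_of_shaAn_unit {W : WeierstrassCurve ℚ}
    [W.IsElliptic] [W.IsGloballyMinimal]
    (hDel : Delbourgo1998.prop4_rankZero_pow_dvd_constantCoeff)
    (hGZK : rank_eq_analyticRank_of_analyticRank_le_one) (hmod : hasEntireLFunction_rat)
    (hmodD : nonempty_modularParametrizationData)
    (hBCodd : ChiBranchLeadingTermOddAt W 3) (hX : ClassX3M W 3) (hr : W.analyticRank = 0)
    {q : ℚ} (hq : shaAn W = (q : ℂ)) (hv : padicValRat 3 q = 0) : BSDp W 3 :=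
  bsdp_of_missingPPartAt W 3 hGZK (by rw [hr]; exact zero_le_one)
    (missingPPartAt_of_upper_of_shaAn_unit W 3
      (ClassX3M.missingUpperBoundAt_three_rankZero_of_chiBranchOdd hDel hGZK hmod hmodD hBCodd hX
        hr) hq hv)

end Summit.BirchSwinnertonDyer.Rank1Residual.AdditivePotMult

end
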